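import Mathlib

/-!
HONEST FRAMING: exact (Metropolis-corrected) sampling algorithms for lattice gauge theory; figures
of merit are autocorrelation/cost numbers at stated couplings and volumes; no continuum-physics
claim.

# MinNetworkElimination — THE WEIGHTED MIN-CONDUCTANCE NETWORKS WITH PROPORTIONAL GROUNDS ARE CLOSED UNDER ELIMINATION OF THE SHALLOWEST NODE: SCHUR-ELIMINATING `o` WITH
# `ρ_o = min ρ` FROM `κN_vρ_vφ_v + βΣ_u N_uN_v·min(ρ_u,ρ_v)(φ_v − φ_u) = f_v` LEAVES THE SAME SYSTEM ON `A ∖ {o}` WITH EVERY DEPTH SHIFTED BY `c = θN_oρ_o`,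
# `θ = β/(κ + βΣ_{u≠o}N_u)`, AND SOURCE `f_v + θN_vf_o`; HENCE POTENTIALS EXIST FOR EVERY SOURCE (lean-2 GEN-38, ours)

Venture-side (OURS).  Cell `lqcd-flow` (pub-lqcd), unit `pub-lqcd-lean-2-g38`, 2026-08-30.  Chapter W (item 1 (i) at finite swap odds), file 24.  The σ-discounted Green kernel of the
tagged hub chain of files 14–23 (`G_σ = Σ_j σ^jP^j = H⁻¹D_m`, `H = (1−σ)D_m + σ·Laplacian`) is the inverse of the operator of a resistor network whose conductances are
`(σ/K)·N_uN_v·min(ρ_u,ρ_v)` (`ρ = 1/W` the depth = impersistence, `N` the class sizes, the tagged particle a class of size one) and whose grounds are `(1−σ)N_vρ_v`.  This file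
isolates that class — weights `N > 0`, depths `ρ > 0`, edge factor `β ≥ 0`, ground factor `κ > 0`, operator
`(Lφ)(v) = κN_vρ_vφ(v) + βΣ_{u∈A∖v} N_uN_v·min(ρ_u,ρ_v)(φ(v) − φ(u))` on a finite node set `A` (the operator is a user-supplied function `L A ρ φ v` given by its
hypothesis-equation, so no definition is introduced) — and proves the identity behind MEMO-gen38: if `o ∈ A` is a SHALLOWEST node (`ρ_o ≤ ρ_u`), then with
`D = κ + βΣ_{u∈A∖o}N_u`, `θ = β/D`, `T = N_oρ_oD`, `c = θN_oρ_o`,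
* the row at `o` reads `Tφ(o) − βN_oρ_oΣ_{u∈A∖o}N_uφ(u)` (`minNet_row_shallow`), i.e. `Lφ = f` at `o` iff `φ(o) = f_o/T + θΣ_{u∈A∖o}N_uφ(u)`;
* given that value of `φ(o)`, for every other `v ∈ A`: `(L_{A,ρ}φ)(v) = (L_{A∖o, ρ+c}φ)(v) − θN_vf_o` (`minNet_row_reduce`) — the reduced network is IN THE CLASS, all depths shifted by
  the same `c ≥ 0` (so the order of the remaining nodes is kept);
* hence `Lφ = f` on `A` ⟺ [`φ(o)` as above and `L_{A∖o,ρ+c}φ = f + θf_oN` on `A∖o`] (`minNet_restrict`, `minNet_lift`), and by induction on `|A|` a potential EXISTS for every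
  source (`minNet_exists`).
File 25 (`MinNetworkMonotone`) runs the comparison induction on this identity; file 26 bridges to the tagged chains.  Hypothesis-equations, no definitions.

## What is proved

* `minNet_row_shallow`, `minNet_row_reduce`, `minNet_restrict`, `minNet_lift`, `minNet_congr`, **`minNet_exists`**.

Reading (no numerics implied): Schur complement of one node in a resistor network (star–mesh transform); the closure of the min-kernel class under it is the new remark.
Literature grade (cell rule): OWN, elementary; nothing cited as a fact; no new bib keys.
-/

open Finset

namespace Summit.Ventures.LatticeQCDFlow.Scaling

section MinNet
variable {ι : Type*} [DecidableEq ι]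
variable {N : ι → ℝ} {β κ : ℝ} {L : Finset ι → (ι → ℝ) → (ι → ℝ) → ι → ℝ}

/-- **The row of a shallowest node:** if `ρ_o ≤ ρ_u` on `A`, then `(Lφ)(o) = N_oρ_o(κ + βΣ_{u∈A∖o}N_u)·φ(o) − βN_oρ_o·Σ_{u∈A∖o}N_uφ(u)`. [ours] -/
theorem minNet_row_shallow (hL : ∀ A ρ φ v, L A ρ φ v = κ * (N v * ρ v) * φ v + β * ∑ u ∈ A.erase v, N u * N v * min (ρ u) (ρ v) * (φ v - φ u))
    {A : Finset ι} {o : ι} {ρ : ι → ℝ} (hmin : ∀ u ∈ A, ρ o ≤ ρ u) (φ : ι → ℝ) :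
    L A ρ φ o = N o * ρ o * (κ + β * ∑ u ∈ A.erase o, N u) * φ o - β * (N o * ρ o) * ∑ u ∈ A.erase o, N u * φ u := by
  rw [hL]
  have e : ∀ u ∈ A.erase o, N u * N o * min (ρ u) (ρ o) * (φ o - φ u) = N o * ρ o * φ o * N u - N o * ρ o * (N u * φ u) := by
    intro u hu; rw [min_eq_right (hmin u (mem_of_mem_erase hu))]; ring
  rw [sum_congr rfl e, sum_sub_distrib, ← mul_sum, ← mul_sum]
  ring

/-- **The elimination identity:** with `o` shallowest, `D = κ + βΣ_{u∈A∖o}N_u ≠ 0`, `θ = β/D`, `c = θN_oρ_o` and `φ(o) = f_o/(N_oρ_oD) + θΣ_{u∈A∖o}N_uφ(u)`, for every other node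
`v ∈ A`: `(L_{A,ρ}φ)(v) = (L_{A∖o,ρ+c}φ)(v) − θN_vf_o` — the same class, every depth shifted by `c`. [ours] -/
theorem minNet_row_reduce (hL : ∀ A ρ φ v, L A ρ φ v = κ * (N v * ρ v) * φ v + β * ∑ u ∈ A.erase v, N u * N v * min (ρ u) (ρ v) * (φ v - φ u))
    {A : Finset ι} {o v : ι} (ho : o ∈ A) (hv : v ∈ A) (hvo : v ≠ o) {ρ φ f : ι → ℝ} (hmin : ∀ u ∈ A, ρ o ≤ ρ u)
    {D θ c : ℝ} (hD : D = κ + β * ∑ u ∈ A.erase o, N u) (hD0 : D ≠ 0) (hNo : N o ≠ 0) (hρo : ρ o ≠ 0) (hθ : θ = β / D) (hc : c = θ * (N o * ρ o))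
    (hφo : φ o = f o / (N o * ρ o * D) + θ * ∑ u ∈ A.erase o, N u * φ u) :
    L A ρ φ v = L (A.erase o) (fun u => ρ u + c) φ v - θ * N v * f o := by
  rw [hL, hL]
  have hoAv : o ∈ A.erase v := mem_erase.mpr ⟨hvo.symm, ho⟩
  rw [← add_sum_erase (A.erase v) _ hoAv, show (A.erase v).erase o = (A.erase o).erase v from erase_right_comm,
    min_eq_left (hmin v hv)]
  have e2 : ∀ u ∈ (A.erase o).erase v, N u * N v * min (ρ u + c) (ρ v + c) * (φ v - φ u)
      = N u * N v * min (ρ u) (ρ v) * (φ v - φ u) + (c * (N v * φ v) * N u - c * N v * (N u * φ u)) := by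
    intro u _; rw [min_add_add_right]; ring
  rw [sum_congr rfl e2, sum_add_distrib, sum_sub_distrib, ← mul_sum, ← mul_sum]
  have hvB : v ∈ A.erase o := mem_erase.mpr ⟨hvo, hv⟩
  have s1 : ∑ u ∈ (A.erase o).erase v, N u = (∑ u ∈ A.erase o, N u) - N v := by
    rw [← add_sum_erase _ _ hvB]; ring
  have s2 : ∑ u ∈ (A.erase o).erase v, N u * φ u = (∑ u ∈ A.erase o, N u * φ u) - N v * φ v := by
    rw [← add_sum_erase _ _ hvB]; ring
  rw [s1, s2, hφo, hc, hθ]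
  rw [hD] at hD0 ⊢
  field_simp
  ring

/-- **Restriction:** if `Lφ = f` on `A` and `o` is shallowest, then `φ(o) = f_o/T + θΣN_uφ(u)` and the restriction solves the reduced system with source `f + θf_oN`. [ours] -/
theorem minNet_restrict (hL : ∀ A ρ φ v, L A ρ φ v = κ * (N v * ρ v) * φ v + β * ∑ u ∈ A.erase v, N u * N v * min (ρ u) (ρ v) * (φ v - φ u))
    {A : Finset ι} {o : ι} (ho : o ∈ A) {ρ φ f : ι → ℝ} (hmin : ∀ u ∈ A, ρ o ≤ ρ u)
    {D θ c : ℝ} (hD : D = κ + β * ∑ u ∈ A.erase o, N u) (hD0 : D ≠ 0) (hNo : N o ≠ 0) (hρo : ρ o ≠ 0) (hθ : θ = β / D) (hc : c = θ * (N o * ρ o))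
    (hφ : ∀ v ∈ A, L A ρ φ v = f v) :
    φ o = f o / (N o * ρ o * D) + θ * ∑ u ∈ A.erase o, N u * φ u ∧
      ∀ v ∈ A.erase o, L (A.erase o) (fun u => ρ u + c) φ v = f v + θ * N v * f o := by
  have hφo : φ o = f o / (N o * ρ o * D) + θ * ∑ u ∈ A.erase o, N u * φ u := by
    have h := hφ o ho
    rw [minNet_row_shallow hL hmin φ, ← hD] at h
    rw [hθ]
    field_simp
    linear_combination h
  refine ⟨hφo, fun v hv => ?_⟩
  have hvA : v ∈ A := mem_of_mem_erase hv
  have hvo : v ≠ o := ne_of_mem_erase hv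
  have h := minNet_row_reduce hL ho hvA hvo hmin hD hD0 hNo hρo hθ hc hφo
  rw [hφ v hvA] at h
  linarith

/-- **Lifting:** if `φ(o) = f_o/T + θΣN_uφ(u)` and `φ` solves the reduced system on `A∖o` with source `f + θf_oN`, then `Lφ = f` on `A`. [ours] -/
theorem minNet_lift (hL : ∀ A ρ φ v, L A ρ φ v = κ * (N v * ρ v) * φ v + β * ∑ u ∈ A.erase v, N u * N v * min (ρ u) (ρ v) * (φ v - φ u))
    {A : Finset ι} {o : ι} (ho : o ∈ A) {ρ φ f : ι → ℝ} (hmin : ∀ u ∈ A, ρ o ≤ ρ u)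
    {D θ c : ℝ} (hD : D = κ + β * ∑ u ∈ A.erase o, N u) (hD0 : D ≠ 0) (hNo : N o ≠ 0) (hρo : ρ o ≠ 0) (hθ : θ = β / D) (hc : c = θ * (N o * ρ o))
    (hφo : φ o = f o / (N o * ρ o * D) + θ * ∑ u ∈ A.erase o, N u * φ u)
    (hred : ∀ v ∈ A.erase o, L (A.erase o) (fun u => ρ u + c) φ v = f v + θ * N v * f o) :
    ∀ v ∈ A, L A ρ φ v = f v := by
  intro v hvA
  by_cases hvo : v = o
  · subst hvo
    rw [minNet_row_shallow hL hmin φ, ← hD, hφo, hθ]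
    field_simp
    ring
  · have h := minNet_row_reduce hL ho hvA hvo hmin hD hD0 hNo hρo hθ hc hφo
    rw [hred v (mem_erase.mpr ⟨hvo, hvA⟩)] at h
    linarith

/-- The operator only reads `φ` on `A`: two functions agreeing on `A` have the same image. [ours] -/
theorem minNet_congr (hL : ∀ A ρ φ v, L A ρ φ v = κ * (N v * ρ v) * φ v + β * ∑ u ∈ A.erase v, N u * N v * min (ρ u) (ρ v) * (φ v - φ u))
    {A : Finset ι} {ρ φ φ' : ι → ℝ} (hagree : ∀ u ∈ A, φ u = φ' u) {v : ι} (hv : v ∈ A) : L A ρ φ v = L A ρ φ' v := by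
  rw [hL, hL, hagree v hv]
  congr 1
  congr 1
  exact sum_congr rfl fun u hu => by rw [hagree u (mem_of_mem_erase hu)]

/-- **EXISTENCE OF POTENTIALS:** for weights `N > 0` and depths `ρ > 0` on `A`, ground factor `κ > 0` and edge factor `β ≥ 0`, the system `Lφ = f` on `A` has a solution for every
source `f` (induction on `|A|`: solve the reduced system on `A∖o`, `o` shallowest, and lift). [ours] -/
theorem minNet_exists (hL : ∀ A ρ φ v, L A ρ φ v = κ * (N v * ρ v) * φ v + β * ∑ u ∈ A.erase v, N u * N v * min (ρ u) (ρ v) * (φ v - φ u))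
    (hκ : 0 < κ) (hβ : 0 ≤ β) :
    ∀ (n : ℕ) (A : Finset ι), A.card = n → (∀ v ∈ A, 0 < N v) → ∀ (ρ f : ι → ℝ), (∀ v ∈ A, 0 < ρ v) →
      ∃ φ : ι → ℝ, ∀ v ∈ A, L A ρ φ v = f v := by
  intro n
  induction n with
  | zero =>
    intro A hA _ ρ f _
    refine ⟨fun _ => 0, ?_⟩
    rw [Finset.card_eq_zero] at hA
    subst hA
    simp
  | succ n ih =>
    intro A hA hN ρ f hρ
    have hne : A.Nonempty := by rw [← Finset.card_pos, hA]; exact Nat.succ_pos n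
    obtain ⟨o, ho, hmin⟩ := exists_min_image A ρ hne
    have hS0 : 0 ≤ ∑ u ∈ A.erase o, N u := sum_nonneg fun u hu => (hN u (mem_of_mem_erase hu)).le
    have hD0 : 0 < κ + β * ∑ u ∈ A.erase o, N u := add_pos_of_pos_of_nonneg hκ (mul_nonneg hβ hS0)
    have hNo : 0 < N o := hN o ho
    have hρo : 0 < ρ o := hρ o ho
    have hθ0 : 0 ≤ β / (κ + β * ∑ u ∈ A.erase o, N u) := div_nonneg hβ hD0.le
    have hc0 : 0 ≤ β / (κ + β * ∑ u ∈ A.erase o, N u) * (N o * ρ o) := mul_nonneg hθ0 (mul_nonneg hNo.le hρo.le)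
    have hcard : (A.erase o).card = n := by rw [card_erase_of_mem ho, hA]; simp
    obtain ⟨φ', hφ'⟩ := ih (A.erase o) hcard (fun v hv => hN v (mem_of_mem_erase hv))
      (fun u => ρ u + β / (κ + β * ∑ u ∈ A.erase o, N u) * (N o * ρ o))
      (fun v => f v + β / (κ + β * ∑ u ∈ A.erase o, N u) * N v * f o)
      (fun v hv => add_pos_of_pos_of_nonneg (hρ v (mem_of_mem_erase hv)) hc0)
    -- extend `φ'` to `o` by the eliminated row
    refine ⟨Function.update φ' o (f o / (N o * ρ o * (κ + β * ∑ u ∈ A.erase o, N u))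
      + β / (κ + β * ∑ u ∈ A.erase o, N u) * ∑ u ∈ A.erase o, N u * φ' u), ?_⟩
    have hagree : ∀ u ∈ A.erase o, Function.update φ' o (f o / (N o * ρ o * (κ + β * ∑ u ∈ A.erase o, N u))
        + β / (κ + β * ∑ u ∈ A.erase o, N u) * ∑ u ∈ A.erase o, N u * φ' u) u = φ' u :=
      fun u hu => Function.update_of_ne (ne_of_mem_erase hu) _ _
    refine minNet_lift hL ho hmin rfl hD0.ne' hNo.ne' hρo.ne' rfl rfl ?_ ?_
    · rw [Function.update_self]
      congr 1
      congr 1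
      exact sum_congr rfl fun u hu => by rw [hagree u hu]
    · intro v hv
      rw [minNet_congr hL hagree hv]
      exact hφ' v hv

end MinNet

end Summit.Ventures.LatticeQCDFlow.Scaling
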